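import Literature.RingTheory.GradedAlgebra.IsolatedComponentRegularity
import Literature.RingTheory.CompleteIntersection.BezoutianDuality
import Literature.RingTheory.CompleteIntersection.IsolatedPrimeReduction
import Literature.NumberTheory.Transcendental.NesterenkoHilbertBound
import Literature.NumberTheory.Transcendental.NesterenkoEliminationPrimeForm
import Mathlib.RingTheory.AlgebraicIndependent.Transcendental
import HarnessLib

/-!
# Chardin–Philippon regularity of isolated points: proof of `chardinPhilippon_isolatedInterpolation`

Topic `Literature/RingTheory/GradedAlgebra` (Castelnuovo–Mumford regularity, 13D40; complete
intersections, 14M10). This file discharges the named fact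
`Literature.RingTheory.GradedAlgebra.chardinPhilippon_isolatedInterpolation`
(`IsolatedComponentRegularity.lean`): for forms `g₁, …, g_k ∈ ℚ[x₀, …, x_m]` of degrees `eⱼ ≥ 1`
and a homogeneous prime `𝔮` with `dim ℚ[x̲]/𝔮 = 1` which is a MINIMAL prime of `(g₁, …, g_k)`,
the zeros of `𝔮` impose independent conditions on the forms of every degree `ν` with
`∑ eⱼ + 1 ≤ ν + m`: `dim_ℚ ℚ[x̲]_ν = dim_ℚ (ℚ[x̲]_ν ∩ 𝔮) + deg 𝔮`
(`chardinPhilippon_isolatedInterpolation_holds`; in fact `∑ eⱼ ≤ ν + m` suffices,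
`finrank_eq_of_mem_minimalPrimes`).

## The proof

The printed proof of [ChardinPhilippon1999] (liaison and local cohomology with supports in the
isolated part) bounds the regularity of the whole, possibly non-reduced, isolated zero-dimensional
part. The special form recorded in the tree only concerns a REDUCED component defined over `ℚ`
(a prime `𝔮`), and for it an elementary affine argument is available, which is the one formalised
here (all its ingredients are proved in the tree):

1. *Chart.* `𝔮` misses a variable `x_c` (`exists_X_notMem_of_rank`); the data `(𝔮, s = 0, c)` is a
   generic section datum `𝒢 : GSec m` of Nesterenko's theory, which provides the field `𝕃 ⊇ ℚ`
   and the normalised generic zero `ρ ∈ 𝕃^{m+1}` of `𝔮` (`ρ_c = 1`), with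
   `G(ρ) = 0 ↔ G ∈ 𝔮` for forms `G` (`aeval_rho_eq_zero_iff_of_isHomogeneous`) and
   `deg 𝔮 = [K'(ρ) : K']` (`GSec.finrank_L0_eq_ideg`).
2. *Affine point.* On the chart `x_c = 1` the dehomogenised prime `𝔮' = affIdeal c 𝔮 ⊂ ℚ[y₁, …, y_m]`
   is the kernel of evaluation at `P = (ρ_{c.succAbove i})ᵢ` (`aeval_affine_eq_zero_iff`); it is a
   closed point (`dim = 0`, residue field algebraic over `ℚ`: `trdeg_quotient_affIdeal_lt`), and it
   is still a minimal prime of the dehomogenised equations (`affIdeal_mem_minimalPrimes`: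
   a prime between them homogenises to a homogeneous prime between `(g)` and `𝔮`).
3. *Reduction to `m` equations and isolation.* By
   `Literature.RingTheory.CompleteIntersection.exists_reduction_of_mem_minimalPrimes`, `𝔮'` is a
   minimal prime of `m` combinations `H₁, …, H_m` of the dehomogenised `gⱼ` with `deg Hᵢ ≤ fᵢ`,
   `∑ fᵢ ≤ ∑ eⱼ`, and `u 𝔮'ᴺ ⊆ (H)` for some `u ∉ 𝔮'`
   (`Literature.RingTheory.CompleteIntersection.exists_notMem_forall_mul_mem_of_mem_minimalPrimes`).
4. *Interpolation at an isolated zero.* The affine theorem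
   `Literature.RingTheory.CompleteIntersection.exists_totalDegree_le_aeval_eq_of_isolated`
   (Bezoutians and Tate–Wiebe local duality, after [DeSmitRubinSchoof1997]) gives: every element of
   `ℚ[P]` is `a(P)` with `deg a ≤ ν` as soon as `∑ fᵢ ≤ ν + m`. Homogenising, evaluation at `ρ`
   maps the forms of degree `ν` ONTO `ℚ[ρ] = ℚ[P]`, with kernel `𝔮_ν` (step 1).
5. *Counting.* Rank–nullity gives `H(𝔮; ν) = dim_ℚ ℚ[ρ]`; `deg 𝔮 = [K'(ρ) : K'] ≤ dim_ℚ ℚ[ρ]`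
   (`ideg_le_finrank`: a `ℚ`-basis of `ℚ[ρ]` spans `K'(ρ)` over `K'`), and Nesterenko's bound
   `H(𝔮; ν) ≤ deg 𝔮` (`GSec.hilbert_le` with `s = 0`) gives the reverse inequality.

## References

* [ChardinPhilippon1999] M. Chardin, P. Philippon, *Régularité et interpolation*, J. Algebraic
  Geom. 8 (1999), no. 3, 471–481; erratum ibid. 11 (2002) 599–600 — the theorem (régularité des
  points isolés), here in the reduced `ℚ`-rational special case of `IsolatedComponentRegularity.lean`.
* [DeSmitRubinSchoof1997] B. de Smit, K. Rubin, R. Schoof, *Criteria for complete intersections*,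
  in: Modular Forms and Fermat's Last Theorem (Springer, 1997), 343–356 — Tate–Wiebe duality
  (`BezoutianDuality.lean`, `TransitionDeterminant.lean`).
* [NesterenkoPhilippon2001] Yu. V. Nesterenko, P. Philippon (eds.), *Introduction to Algebraic
  Independence Theory*, LNM 1752 (2001), Ch. 3 Prop. 4.11 and Ch. 10 Lemma 3.1 (degree of a prime
  via the generic section; the Hilbert-function bound).
* [Hartshorne1977] R. Hartshorne, *Algebraic Geometry*, GTM 52, I §2 (affine charts of `ℙᵐ`).
-/

noncomputable section

set_option synthInstance.maxHeartbeats 400000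

open MvPolynomial Module
open Literature.AlgebraicGeometry.Motives
open Literature.NumberTheory.Transcendental Literature.NumberTheory.Transcendental.Nesterenko

namespace Literature.RingTheory.GradedAlgebra

variable {m : ℕ}

/-! ### Dehomogenisation and evaluation -/

/-- Evaluating `G(x_c := 1)` at `(z_{c.succAbove i})ᵢ` is evaluating `G` at `z`, when `z_c = 1`.
[folklore] -/
theorem aeval_dehomogenize {S : Type*} [CommRing S] [Algebra ℚ S] (c : Fin (m + 1))
    (z : Fin (m + 1) → S) (hz : z c = 1) (G : Rx m) :
    aeval (fun i => z (c.succAbove i)) (ProjectiveSpace.dehomogenize ℚ c G) = aeval z G := by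
  unfold ProjectiveSpace.dehomogenize
  rw [← AlgHom.comp_apply, MvPolynomial.comp_aeval]
  have hfun : (fun s => aeval (fun i => z (c.succAbove i))
      (Fin.insertNth (α := fun _ => Aff m) c 1 X s)) = z := by
    funext s
    rcases Fin.eq_self_or_eq_succAbove c s with rfl | ⟨i, rfl⟩
    · rw [Fin.insertNth_apply_same, map_one, hz]
    · rw [Fin.insertNth_apply_succAbove, aeval_X]
  rw [hfun]

/-- Dehomogenising does not increase the total degree. [folklore] -/
theorem totalDegree_dehomogenize_le (c : Fin (m + 1)) (G : Rx m) :
    (ProjectiveSpace.dehomogenize ℚ c G).totalDegree ≤ G.totalDegree := by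
  unfold ProjectiveSpace.dehomogenize
  refine Literature.Computability.AlgebraicComplexity.totalDegree_aeval_le_of_le_one _ (fun s => ?_) G
  rcases Fin.eq_self_or_eq_succAbove c s with rfl | ⟨i, rfl⟩
  · rw [Fin.insertNth_apply_same, totalDegree_one]; exact Nat.zero_le _
  · rw [Fin.insertNth_apply_succAbove]; exact (totalDegree_X i).le

/-- A prime ideal is an associated prime of itself. [folklore] -/
private theorem self_mem_associatedPrimes_aux {R : Type*} [CommRing R] {𝔭 : Ideal R}
    (h𝔭 : 𝔭.IsPrime) : 𝔭 ∈ (𝔭 : Submodule R R).associatedPrimes := by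
  refine Submodule.AssociatePrimes.mem_iff.mpr (Submodule.isAssociatedPrime_def.mpr ⟨h𝔭, 1, ?_⟩)
  have : Submodule.colon (𝔭 : Submodule R R) {(1 : R)} = 𝔭 := by
    ext r; simp [Submodule.mem_colon_singleton]
  rw [this, h𝔭.radical]

/-! ### Zeros of a homogeneous prime of rank `s + 1`: the point `ρ` of `GSec` -/

/-- For a FORM `G`: `G(ρ) = 0 ↔ G ∈ 𝔭` (`ρ = x̄ⱼ⁻¹ ξ`, `ξ` the generic point). [folklore] -/
theorem aeval_rho_eq_zero_iff_of_isHomogeneous (𝒢 : GSec m) {G : Rx m} {d : ℕ} (hG : G.IsHomogeneous d) :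
    aeval 𝒢.rho G = 0 ↔ G ∈ 𝒢.𝔭 := by
  refine ⟨fun h => ?_, 𝒢.aeval_rho_eq_zero⟩
  rw [𝒢.rho_eq_smul_xi, NesterenkoK.aeval_smul_of_isHomogeneous hG] at h
  have hu : algebraMap 𝒢.Lp 𝒢.LL (𝒢.xb 𝒢.j)⁻¹ ≠ 0 :=
    (map_ne_zero _).mpr (inv_ne_zero 𝒢.xb_j_ne_zero)
  exact (𝒢.aeval_xi_eq_zero_iff G).mp ((mul_eq_zero.mp h).resolve_left (pow_ne_zero _ hu))

/-- **The affine point `(ρ_{j.succAbove i})ᵢ` of the chart `x_j = 1` is a zero of exactly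
`𝔭' = affIdeal j 𝔭`.** [folklore] -/
theorem aeval_affine_eq_zero_iff (𝒢 : GSec m) (a : Aff m) :
    aeval (fun i => 𝒢.rho (𝒢.j.succAbove i)) a = 0 ↔ a ∈ affIdeal 𝒢.j 𝒢.𝔭 := by
  obtain ⟨G, hG, rfl⟩ := exists_isHomogeneous_dehomogenize_eq' 𝒢.j a
  rw [aeval_dehomogenize 𝒢.j 𝒢.rho 𝒢.rho_j, aeval_rho_eq_zero_iff_of_isHomogeneous 𝒢 hG,
    dehomogenize_mem_affIdeal_iff_of_isPrime 𝒢.prime 𝒢.hom 𝒢.chart hG]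

/-! ### Minimality passes to the affine chart -/

/-- **An isolated component stays isolated on an affine chart**: if the homogeneous prime `𝔭 ∌ x_j`
(packaged as `𝒢 : GSec m`) is a minimal prime of an ideal generated by forms `hᵢ`, then
`𝔭' = affIdeal j 𝔭` is a minimal prime of `(hᵢ(x_j := 1))ᵢ`. (A prime `Q` between them homogenises
to a homogeneous prime between `(h)` and `𝔭`.)
[cite: Hartshorne1977, I §2 (proof of Prop. 2.2) and Ex. 2.10] -/
theorem affIdeal_mem_minimalPrimes (𝒢 : GSec m) {ι : Type*} {h : ι → Rx m} {d : ι → ℕ}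
    (hh : ∀ i, (h i).IsHomogeneous (d i)) (hmin : 𝒢.𝔭 ∈ (Ideal.span (Set.range h)).minimalPrimes) :
    affIdeal 𝒢.j 𝒢.𝔭 ∈
      (Ideal.span (Set.range fun i => ProjectiveSpace.dehomogenize ℚ 𝒢.j (h i))).minimalPrimes := by
  classical
  letI : GradedAlgebra (homogeneousSubmodule (Fin (m + 1)) ℚ) := MvPolynomial.gradedAlgebra
  haveI hprime := isPrime_affIdeal 𝒢.prime 𝒢.hom 𝒢.chart
  refine ⟨⟨hprime, Ideal.span_le.mpr ?_⟩, fun Q hQ hQle => ?_⟩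
  · rintro _ ⟨i, rfl⟩
    exact dehomogenize_mem_affIdeal 𝒢.j (hmin.1.2 (Ideal.subset_span ⟨i, rfl⟩))
  · obtain ⟨hQp, hJQ⟩ := hQ
    -- the homogeneous ideal `Q'` spanned by the forms whose dehomogenisation lies in `Q`
    let T : Set (Rx m) := {G | ∃ n, G.IsHomogeneous n ∧ ProjectiveSpace.dehomogenize ℚ 𝒢.j G ∈ Q}
    have hQ'hom : (Ideal.span T).IsHomogeneous (homogeneousSubmodule (Fin (m + 1)) ℚ) := by
      refine Ideal.homogeneous_span _ _ fun G hG => ?_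
      obtain ⟨n, hn, -⟩ := hG
      exact ⟨n, (mem_homogeneousSubmodule _ _).mpr hn⟩
    have hdeh : ∀ G ∈ Ideal.span T, ProjectiveSpace.dehomogenize ℚ 𝒢.j G ∈ Q := by
      intro G hG
      induction hG using Submodule.span_induction with
      | mem G hG =>
        obtain ⟨-, -, hG⟩ := hG
        exact hG
      | zero => rw [map_zero]; exact Q.zero_mem
      | add G G' _ _ hG hG' => rw [map_add]; exact Q.add_mem hG hG'
      | smul a G _ hG => rw [smul_eq_mul, map_mul]; exact Q.mul_mem_left _ hG
    have hJQ' : Ideal.span (Set.range h) ≤ Ideal.span T := Ideal.span_le.mpr (by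
      rintro _ ⟨i, rfl⟩
      exact Ideal.subset_span ⟨d i, hh i, hJQ (Ideal.subset_span ⟨i, rfl⟩)⟩)
    have hQ'𝔭 : Ideal.span T ≤ 𝒢.𝔭 := Ideal.span_le.mpr (by
      rintro G ⟨n, hn, hG⟩
      exact (dehomogenize_mem_affIdeal_iff_of_isPrime 𝒢.prime 𝒢.hom 𝒢.chart hn).mp (hQle hG))
    have hQ'p : (Ideal.span T).IsPrime := by
      refine hQ'hom.isPrime_of_homogeneous_mem_or_mem
        (fun htop => 𝒢.prime.ne_top (top_le_iff.mp (htop ▸ hQ'𝔭))) ?_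
      intro x y hx hy hxy
      obtain ⟨nx, hnx⟩ := hx
      obtain ⟨ny, hny⟩ := hy
      have h1 := hdeh _ hxy
      rw [map_mul] at h1
      rcases hQp.mem_or_mem h1 with h2 | h2
      · exact Or.inl (Ideal.subset_span ⟨nx, (mem_homogeneousSubmodule _ _).mp hnx, h2⟩)
      · exact Or.inr (Ideal.subset_span ⟨ny, (mem_homogeneousSubmodule _ _).mp hny, h2⟩)
    have h𝔭Q' : 𝒢.𝔭 ≤ Ideal.span T := hmin.2 ⟨hQ'p, hJQ'⟩ hQ'𝔭
    intro a ha
    obtain ⟨G, hG𝔭, rfl⟩ := (mem_affIdeal_iff 𝒢.j 𝒢.𝔭 a).mp ha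
    exact hdeh G (h𝔭Q' hG𝔭)

/-! ### The degree of a prime is at most the `ℚ`-dimension of `ℚ[ρ]` -/

set_option maxHeartbeats 800000 in
/-- **`deg 𝔭 ≤ dim_ℚ V`** for every finite-dimensional `ℚ`-subspace `V` of `𝕃` containing the
`ℚ`-algebra generated by the coordinates of `ρ` (`deg 𝔭 = [K'(ρ) : K']`, and a `ℚ`-basis of `V`
spans `K'(ρ)` over `K'`). [cite: NesterenkoPhilippon2001, Ch. 3 Prop. 4.11 (pp. 40–41)] -/
theorem ideg_le_finrank (𝒢 : GSec m) (V : Submodule ℚ 𝒢.LL) [FiniteDimensional ℚ V]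
    (hV : (Algebra.adjoin ℚ (Set.range 𝒢.rho) : Set 𝒢.LL) ⊆ V) :
    ideg 𝒢.𝔭 (𝒢.s + 1) ≤ finrank ℚ V := by
  -- the `ℚ`-structure of `K' = Frac ℚ[U']` coming from `ℚ[U']` (not `DivisionRing.toRatAlgebra`)
  haveI : IsScalarTower ℚ 𝒢.Kp 𝒢.LL :=
    @IsScalarTower.of_algebraMap_eq' ℚ 𝒢.Kp 𝒢.LL _ _ _ OreLocalization.instAlgebra _ _
      (RingHom.ext_rat _ _)
  rw [← 𝒢.finrank_L0_eq_ideg]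
  set b := Module.finBasis ℚ V
  set f : Fin (finrank ℚ V) → 𝒢.LL := V.subtype ∘ b with hf
  have hVf : Submodule.span ℚ (Set.range f) = V := by
    rw [hf, Set.range_comp, Submodule.span_image, b.span_eq, Submodule.map_subtype_top]
  have hVspan : (V : Set 𝒢.LL) ⊆ Submodule.span 𝒢.Kp (Set.range f) := by
    intro x hx
    rw [← Submodule.span_span_of_tower ℚ 𝒢.Kp (Set.range f), hVf]
    exact Submodule.subset_span hx
  have hle : Subalgebra.toSubmodule 𝒢.L0.toSubalgebra ≤ Submodule.span 𝒢.Kp (Set.range f) := by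
    have hL0 : 𝒢.L0.toSubalgebra = Algebra.adjoin 𝒢.Kp (Set.range 𝒢.rho) :=
      IntermediateField.adjoin_toSubalgebra_of_isAlgebraic fun _ ⟨k, hk⟩ => hk ▸ 𝒢.isAlgebraic_rho k
    rw [hL0, Algebra.adjoin_eq_span]
    refine Submodule.span_le.mpr fun x hx => hVspan (hV ?_)
    exact (Submonoid.closure_le (S := (Algebra.adjoin ℚ (Set.range 𝒢.rho)).toSubmonoid)).mpr
      Algebra.subset_adjoin hx
  haveI : FiniteDimensional 𝒢.Kp (Submodule.span 𝒢.Kp (Set.range f)) :=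
    FiniteDimensional.span_of_finite _ (Set.finite_range f)
  calc finrank 𝒢.Kp 𝒢.L0 = finrank 𝒢.Kp (Subalgebra.toSubmodule 𝒢.L0.toSubalgebra) := by
          rw [Subalgebra.finrank_toSubmodule, IntermediateField.finrank_eq_finrank_subalgebra]
    _ ≤ finrank 𝒢.Kp (Submodule.span 𝒢.Kp (Set.range f)) := Submodule.finrank_mono hle
    _ ≤ Fintype.card (Fin (finrank ℚ V)) := finrank_range_le_card f
    _ = finrank ℚ V := Fintype.card_fin _

/-! ### The theorem for a prime packaged as `GSec` data with `s = 0` -/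

set_option maxHeartbeats 800000 in
/-- **Interpolation on an isolated reduced `ℚ`-component** (the heart of
`chardinPhilippon_isolatedInterpolation_holds`, for a rank-one homogeneous prime packaged with a
chart as `𝒢 : GSec m`, `𝒢.s = 0`): if `𝔭` is a minimal prime of forms `g₁, …, g_k` of degrees
`eⱼ ≥ 1` and `∑ eⱼ ≤ ν + m`, then `dim ℚ[x̲]_ν = dim (ℚ[x̲]_ν ∩ 𝔭) + deg 𝔭`.
[cite: ChardinPhilippon1999, Théorème (régularité des points isolés) + erratum 2002] -/
theorem finrank_eq_of_mem_minimalPrimes (𝒢 : GSec m) (hs : 𝒢.s = 0) {k : ℕ}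
    (g : Fin k → Rx m) (e : Fin k → ℕ) (hg : ∀ j, (g j).IsHomogeneous (e j) ∧ 1 ≤ e j)
    (hmin : 𝒢.𝔭 ∈ (Ideal.span (Set.range g)).minimalPrimes) {ν : ℕ} (hν : ∑ j, e j ≤ ν + m) :
    finrank ℚ ↥(homogeneousSubmodule (Fin (m + 1)) ℚ ν) =
      finrank ℚ ↥(homogeneousSubmodule (Fin (m + 1)) ℚ ν ⊓ 𝒢.𝔭.restrictScalars ℚ) +
        ideg 𝒢.𝔭 1 := by
  classical
  have hrank : ringKrullDim (Rx m ⧸ 𝒢.𝔭) = (1 : ℕ) := by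
    have h := 𝒢.rank
    rwa [hs, Nat.zero_add] at h
  -- the affine chart `x_j = 1`: the closed point `𝔮'`, its dimension and its residue field
  set 𝔮' : Ideal (Aff m) := affIdeal 𝒢.j 𝒢.𝔭 with h𝔮'
  haveI h𝔮'p : 𝔮'.IsPrime := isPrime_affIdeal 𝒢.prime 𝒢.hom 𝒢.chart
  haveI : Algebra.FiniteType ℚ (Aff m ⧸ 𝔮') :=
    Algebra.FiniteType.of_surjective (Ideal.Quotient.mkₐ ℚ 𝔮') (Ideal.Quotient.mkₐ_surjective ℚ _)
  have htr : Algebra.trdeg ℚ (Aff m ⧸ 𝔮') < (1 : ℕ) :=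
    trdeg_quotient_affIdeal_lt 𝒢.prime 𝒢.hom 𝒢.chart hrank
  obtain ⟨t, htdim, httr⟩ :=
    Literature.RingTheory.KrullDimension.exists_ringKrullDim_eq_and_trdeg_eq ℚ (Aff m ⧸ 𝔮')
  have ht0 : t = 0 := by
    rw [httr] at htr
    have : t < 1 := by exact_mod_cast htr
    omega
  rw [ht0] at htdim httr
  have hdim0 : ringKrullDim (Aff m ⧸ 𝔮') = 0 := by exact_mod_cast htdim
  haveI halg : Algebra.IsAlgebraic ℚ (Aff m ⧸ 𝔮') := by
    rw [← trdeg_eq_zero_iff]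
    exact_mod_cast httr
  -- the point `P` of the chart and its kernel
  set P : Fin m → 𝒢.LL := fun i => 𝒢.rho (𝒢.j.succAbove i) with hP
  have hker : ∀ a : Aff m, aeval P a = 0 ↔ a ∈ 𝔮' := fun a => aeval_affine_eq_zero_iff 𝒢 a
  have hint : ∀ i, IsIntegral ℚ (P i) := by
    intro i
    let φ : (Aff m ⧸ 𝔮') →ₐ[ℚ] 𝒢.LL :=
      Ideal.Quotient.liftₐ 𝔮' (aeval P) fun a ha => (hker a).mpr ha
    have hφ : φ (Ideal.Quotient.mk 𝔮' (X i)) = P i := by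
      change Ideal.Quotient.lift 𝔮' ((aeval P : Aff m →ₐ[ℚ] 𝒢.LL) : Aff m →+* 𝒢.LL) _
        (Ideal.Quotient.mk 𝔮' (X i)) = P i
      rw [Ideal.Quotient.lift_mk, AlgHom.coe_toRingHom, aeval_X]
    rw [← hφ]
    exact ((halg.isAlgebraic _).algHom φ).isIntegral
  -- the dehomogenised forms and the reduction to `m` of them
  set G : Fin k → Aff m := fun j => ProjectiveSpace.dehomogenize ℚ 𝒢.j (g j) with hG
  have hGdeg : ∀ j, (G j).totalDegree ≤ e j := fun j =>
    (totalDegree_dehomogenize_le 𝒢.j (g j)).trans (hg j).1.totalDegree_le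
  have hminG : 𝔮' ∈ (Ideal.span (Set.range G)).minimalPrimes :=
    affIdeal_mem_minimalPrimes 𝒢 (fun j => (hg j).1) hmin
  obtain ⟨H, f, hHG, hf1, hHdeg, hfsum, hminH⟩ :=
    Literature.RingTheory.CompleteIntersection.exists_reduction_of_mem_minimalPrimes 𝔮' hdim0 G e
      (fun j => (hg j).2) hGdeg hminG
  -- isolation: `u 𝔮'^N ⊆ (H)` with `u ∉ 𝔮'`
  obtain ⟨u, hu, N, huN⟩ :=
    Literature.RingTheory.CompleteIntersection.exists_notMem_forall_mul_mem_of_mem_minimalPrimes hminH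
  have hGle : Ideal.span (Set.range G) ≤ 𝔮' := hminG.1.2
  have hP0 : ∀ i, aeval P (H i) = 0 := fun i => (hker _).mpr (hGle (hHG i))
  have hiso : ∃ u : Aff m, aeval P u ≠ 0 ∧ ∃ N : ℕ, ∀ i,
      u * (Polynomial.aeval (X i : Aff m) (minpoly ℚ (P i))) ^ N ∈ Ideal.span (Set.range H) := by
    refine ⟨u, fun h0 => hu ((hker u).mp h0), N, fun i => huN _ (Ideal.pow_mem_pow ?_ N)⟩
    rw [← hker, ← Polynomial.aeval_algHom_apply, aeval_X, minpoly.aeval]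
  -- **interpolation**: the forms of degree `ν` evaluate onto `ℚ[P] = ℚ[ρ]`
  have hν' : ∑ i, f i ≤ ν + m := hfsum.trans hν
  set W : Submodule ℚ (Rx m) := homogeneousSubmodule (Fin (m + 1)) ℚ ν with hW
  haveI : FiniteDimensional ℚ W := Module.Finite.iff_fg.mpr (homogeneousSubmodule_fg _ _ ν)
  set ev : W →ₗ[ℚ] 𝒢.LL := (aeval 𝒢.rho).toLinearMap.comp W.subtype with hev
  have hev_apply : ∀ w : W, ev w = aeval 𝒢.rho (w : Rx m) := fun w => rfl
  have hsurj : (Algebra.adjoin ℚ (Set.range 𝒢.rho) : Set 𝒢.LL) ⊆ LinearMap.range ev := by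
    -- `ℚ[ρ] ⊆ ℚ[P]` since `ρ_j = 1`
    have hadj : Algebra.adjoin ℚ (Set.range 𝒢.rho) ≤ Algebra.adjoin ℚ (Set.range P) := by
      refine Algebra.adjoin_le ?_
      rintro _ ⟨l, rfl⟩
      rcases Fin.eq_self_or_eq_succAbove 𝒢.j l with rfl | ⟨i, rfl⟩
      · rw [𝒢.rho_j]; exact Subalgebra.one_mem _
      · exact Algebra.subset_adjoin ⟨i, rfl⟩
    intro z hz
    obtain ⟨a, ha, haz⟩ :=
      Literature.RingTheory.CompleteIntersection.exists_totalDegree_le_aeval_eq_of_isolated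
        H f hf1 hHdeg P hint hP0 hiso hν' (hadj hz)
    obtain ⟨G', hG', hG'a⟩ := exists_isHomogeneous_dehomogenize_eq' 𝒢.j a
    have hmem : G' * X 𝒢.j ^ (ν - a.totalDegree) ∈ W := by
      rw [hW, mem_homogeneousSubmodule]
      have := hG'.mul (isHomogeneous_X_pow (R := ℚ) 𝒢.j (ν - a.totalDegree))
      rwa [Nat.add_sub_cancel' ha] at this
    refine LinearMap.mem_range.mpr ⟨⟨G' * X 𝒢.j ^ (ν - a.totalDegree), hmem⟩, ?_⟩
    rw [hev_apply, map_mul, map_pow, aeval_X, 𝒢.rho_j, one_pow, mul_one, ← haz, ← hG'a,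
      aeval_dehomogenize 𝒢.j 𝒢.rho 𝒢.rho_j]
  -- kernel: `𝔭_ν`
  have hkerW : LinearMap.ker ev = Submodule.comap W.subtype (W ⊓ 𝒢.𝔭.restrictScalars ℚ) := by
    ext ⟨Q, hQ⟩
    have hQ' : Q.IsHomogeneous ν := (mem_homogeneousSubmodule ν Q).mp hQ
    simp only [LinearMap.mem_ker, hev_apply, Submodule.mem_comap, Submodule.subtype_apply,
      Submodule.mem_inf, Submodule.restrictScalars_mem]
    rw [aeval_rho_eq_zero_iff_of_isHomogeneous 𝒢 hQ']
    exact ⟨fun h => ⟨hQ, h⟩, fun h => h.2⟩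
  have hfr : finrank ℚ (LinearMap.ker ev) = finrank ℚ ↥(W ⊓ 𝒢.𝔭.restrictScalars ℚ) := by
    rw [hkerW]
    exact LinearEquiv.finrank_eq (Submodule.comapSubtypeEquivOfLe inf_le_left)
  have hrn := LinearMap.finrank_range_add_finrank_ker ev
  -- `dim range = deg 𝔭`
  have hge : ideg 𝒢.𝔭 1 ≤ finrank ℚ (LinearMap.range ev) := by
    have e1 : ideg 𝒢.𝔭 1 = ideg 𝒢.𝔭 (𝒢.s + 1) := by rw [hs]
    rw [e1]
    exact ideg_le_finrank 𝒢 _ hsurj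
  have hle : finrank ℚ W ≤ finrank ℚ ↥(W ⊓ 𝒢.𝔭.restrictScalars ℚ) + ideg 𝒢.𝔭 1 := by
    have hub := 𝒢.hilbert_le ν
    have e : Literature.RingTheory.MvPolynomial.idealDegree 𝒢.𝔭 ν = 𝒢.𝔭.restrictScalars ℚ ⊓ W :=
      rfl
    rw [e, inf_comm, ← hW, hs, Nat.zero_add, zero_mul, pow_zero, mul_one] at hub
    exact tsub_le_iff_left.mp hub
  have hrn' : finrank ℚ (LinearMap.range ev) + finrank ℚ ↥(W ⊓ 𝒢.𝔭.restrictScalars ℚ) =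
      finrank ℚ W := by
    rw [← hfr]; exact hrn
  refine le_antisymm hle ?_
  calc finrank ℚ ↥(W ⊓ 𝒢.𝔭.restrictScalars ℚ) + ideg 𝒢.𝔭 1
      ≤ finrank ℚ ↥(W ⊓ 𝒢.𝔭.restrictScalars ℚ) + finrank ℚ (LinearMap.range ev) :=
        Nat.add_le_add_left hge _
    _ = finrank ℚ W := by rw [add_comm]; exact hrn'

/-! ### The proof -/

/-- **Chardin–Philippon: the isolated (reduced, `ℚ`-rational) zero-dimensional components of the
scheme cut out by forms `g₁, …, g_k` of degrees `e₁, …, e_k` impose independent conditions on the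
forms of every degree `ν ≥ e₁ + ⋯ + e_k + 1 − m`** — discharge of the named fact
`chardinPhilippon_isolatedInterpolation`. Proof (not the printed one by liaison; an elementary
affine argument available because only REDUCED `ℚ`-components are addressed): let `𝒢` be the
rank-one prime `𝔮` with a chart `x_c ∉ 𝔮` (`GSec`); on the chart, `𝔮' = affIdeal c 𝔮` is a closed
point of `𝔸ᵐ_ℚ` (dimension `0`, residue field algebraic) which is an isolated point of the
dehomogenised `gⱼ` (`affIdeal_mem_minimalPrimes`), hence of `m` combinations `H₁, …, H_m` with
`∑ deg Hᵢ ≤ ∑ eⱼ` (`Literature.RingTheory.CompleteIntersection.exists_reduction_of_mem_minimalPrimes`),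
and `u 𝔮'ᴺ ⊆ (H)` for some `u ∉ 𝔮'`
(`Literature.RingTheory.CompleteIntersection.exists_notMem_forall_mul_mem_of_mem_minimalPrimes`).
The affine interpolation theorem at an isolated zero
(`Literature.RingTheory.CompleteIntersection.exists_totalDegree_le_aeval_eq_of_isolated`: Bezoutian
and Tate–Wiebe local duality) then says that evaluation at the point `ρ` of `𝒢` maps the forms of
degree `ν` onto `ℚ[ρ]` as soon as `ν + m ≥ ∑ eⱼ`; its kernel on the forms of degree `ν` is `𝔮_ν`,
so `H(𝔮; ν) = dim_ℚ ℚ[ρ]` (rank–nullity), and `dim_ℚ ℚ[ρ] = deg 𝔮` by `deg 𝔮 ≤ dim_ℚ ℚ[ρ]`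
(`ideg_le_finrank`) and Nesterenko's bound `H(𝔮; ν) ≤ deg 𝔮` (`GSec.hilbert_le`).
[cite: ChardinPhilippon1999, Théorème (régularité des points isolés) + erratum 2002] -/
theorem chardinPhilippon_isolatedInterpolation_holds : chardinPhilippon_isolatedInterpolation := by
  intro m k g e hg 𝔮 h𝔮 hhom hunm hmin ν hν
  have hrank : ringKrullDim (Rx m ⧸ 𝔮) = (1 : ℕ) := hunm.2 𝔮 (self_mem_associatedPrimes_aux h𝔮)
  obtain ⟨c, hc⟩ := exists_X_notMem_of_rank h𝔮 le_rfl hrank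
  obtain ⟨𝒢, h𝒢, hs⟩ : ∃ 𝒢 : GSec m, 𝒢.𝔭 = 𝔮 ∧ 𝒢.s = 0 :=
    ⟨⟨𝔮, 0, c, h𝔮, hhom, hc, by rw [Nat.zero_add]; exact hrank⟩, rfl, rfl⟩
  subst h𝒢
  exact finrank_eq_of_mem_minimalPrimes 𝒢 hs g e hg hmin (by omega)

end Literature.RingTheory.GradedAlgebra

end
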